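import Summits.Ventures.PercRepro2.CaseOneStarCertT1
import Summits.Ventures.PercRepro2.CaseOneGadgetUWA1BBlockIIQ0
import Summits.Ventures.PercRepro2.CaseOneGadgetUWA1BBlockIIQ1
import Summits.Ventures.PercRepro2.CaseOneGadgetUWA1BBlockIIQ2
import Summits.Ventures.PercRepro2.CaseOneGadgetUWA1BBlockIIQ3
import Summits.Ventures.PercRepro2.CaseOneGadgetUWA1BBlockIIQ4
import Summits.Ventures.PercRepro2.CaseOneGadgetUWA1BBlockIIQ5
import Summits.Ventures.PercRepro2.CaseOneGadgetUWA1BBlockIIQ6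
import Summits.Ventures.PercRepro2.CaseOneGadgetUWA1BBlockIIQ7
import Summits.Ventures.PercRepro2.CaseOneGadgetUWA1BBlockIIQ8
import Summits.Ventures.PercRepro2.CaseOneGadgetUWA1BBlockIIQ9
import Summits.Ventures.PercRepro2.CaseOneGadgetUWA1BBlockIIQ10
import Summits.Ventures.PercRepro2.CaseOneGadgetUWA1BBlockIIQ11
import Summits.Ventures.PercRepro2.CaseOneGadgetUWA1BBlockIIQ12
import Summits.Ventures.PercRepro2.CaseOneGadgetUWA1BBlockIIQ13
import Summits.Ventures.PercRepro2.CaseOneGadgetUWA1BBlockIIQ14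

/-!
# The gadget `u ~ {w, a₁, b}`, `w ~ {u, a₂, o}` (uwa1b): the cell certificates of `iiqAB5` (part 62c)
(blind cell PercRepro2, p1 g34; the fourth gadget anchor of the six-form calculus — all six forms of the uwa1b gadget
as plain SFacts-cone certificate chains, generated by mining/p1/g34/uwa1b/genu.py = p1 g33's gent_uwa1.py / g25's
geno.py re-targeted; P1-G33 §6–§6″, P1-G34)

Each `eBABIIQ ijk kl` is a nonnegative combination of `(pairwise atom) × (cell)` and cubic cell monomials — or, for the degree-4 ones, `M × eBABIIQ ijk kl` (`M = Σ cᵢ` the total cell mass) is a nonnegative combination of `(atom) × (cell) × (cell)` and quartic cell monomials, then `SFacts.nonneg_of_sum_mul` (`CaseOneStarCertT1`) — exact LP certificates (kit j318477, every certificate re-verified exactly; data/p1/g33/gcerts_ii_uwa1b.json, form `ii-Q`), here as exact `linear_combination`s over `SFacts` (the rational coefficients cleared by their common denominator). -/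

namespace Summit.Ventures.PercRepro2

namespace CaseOne

section CertABIIQ62c
variable {R : Type*} [Field R] [LinearOrder R] [IsStrictOrderedRing R]

set_option maxHeartbeats 0 in
/-- `eBABIIQ23312 ≥ 0`: the combination is identically zero (`ring`). -/
lemma eBABIIQ23312_nonneg (m : SCells R) (_hf : SFacts m) : 0 ≤ eBABIIQ23312 m := by
  have h : eBABIIQ23312 m = 0 := by
    unfold eBABIIQ23312 cBABIIQ00112 cBABIIQ01012 cBABIIQ01112 cBABIIQ01212 cBABIIQ02112 cBABIIQ02212 cBABIIQ02312 cBABIIQ03212 cBABIIQ03312 cBABIIQ10012 cBABIIQ10112 cBABIIQ10212 cBABIIQ11012 cBABIIQ11112 cBABIIQ11212 cBABIIQ11312 cBABIIQ12012 cBABIIQ12112 cBABIIQ12212 cBABIIQ12312 cBABIIQ13112 cBABIIQ13212 cBABIIQ13312 cBABIIQ20112 cBABIIQ20212 cBABIIQ20312 cBABIIQ21012 cBABIIQ21112 cBABIIQ21212 cBABIIQ21312 cBABIIQ22012 cBABIIQ22112 cBABIIQ22212 cBABIIQ22312 cBABIIQ23012 cBABIIQ23112 cBABIIQ23212 cBA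BIIQ23312
    ring
  linarith [h]

end CertABIIQ62c

end CaseOne

end Summit.Ventures.PercRepro2
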